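import Mathlib
import Summits.ValiantsHypothesis.ValiantsHypothesis.Theses.ValuativeGCT
import Summits.ValiantsHypothesis.ValiantsHypothesis.Theorems.ValuativeGCTValuativeFlipNoSmallBodyEquations
import Summits.ValiantsHypothesis.ValiantsHypothesis.Theorems.ValuativeGCTValuativeFlipBouquetCriterion

/-!
# No equations of `Det_m` up to body `m + 1`

Wall-breaker axis D (det-orbit-closure multiplicity bounds) for crux `ValuativeGCT.ValuativeFlip`
(stmt-ValiantsHypothesis-12624).  The bouquet criterion (`…BouquetCriterion`) pushes the exact
det-side value one unit of body past the landed small-body theorem (`noSmallBodyEquations`, k7 seat 2 /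
k3 seat 2, body `≤ m`):

* `orbitMultiplicity_detFormLex_eq_plethysmCoeff_of_body_le_succ` — weight form, any field of
  characteristic zero: if `|χ| = -mD` and the body `mD + χ i₀ ≤ m + 1` at some letter `i₀`, then
  `mult_χ k[Δ(det_m)] = mult_χ k[Sym^m k^{m×m}]` (no highest-weight vector of weight `χ` vanishes on
  `GL · det_m`; rank–nullity and complete reducibility exactly as in `…NoSmallBodyEquations`).
* `noBodySuccEquations` — partition form over `ℂ`: `K_m(λ*) = a_λ(δ[m])` whenever `bodySize λ ≤ m + 1`.
* `noBodySuccFlip` — crux currency: at body `≤ m + 1` no admissible centre `(U, r)` flips at any inner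
  size `n ≤ m` (`mult_pp ≤ a_λ = K_m ≤ dim T_U`, the last step the proved `ValuativeBound`).
* `body_gt_succ_and_degree_gt_of_flip` — every flip witness `(U, r, δ, λ)` at `(n, m)` has
  `bodySize λ ≥ m + 2` and (Kadish–Landsberg) `n δ ≥ m + 2`.

(The k7-seat-2 axis note expected a possible equation of `Det_m` at body `m + 1`, where its ideal
bound `a - K ≤ p_{>m}(λ̄)` equals `1`; the bouquet closes that gap: the commutative Chow shadow has no
syzygy there either, and the bouquet proves it directly.)  No new definitions. [new]
-/

set_option linter.dupNamespace false

namespace Summit.ValiantsHypothesis.ValiantsHypothesis.Theorems.ValuativeFlip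

open MvPolynomial
open scoped BigOperators Matrix
open Literature.NumberTheory.DiophantineGeometry
open Literature.Computability.AlgebraicComplexity
open Literature.Computability.Complexity

noncomputable section

/-- **No equations of `Det_m` at a weight of body `≤ m + 1`** (weight form, characteristic zero).  If
`|χ| = -mD` and `mD + χ i₀ ≤ m + 1` for some letter `i₀`, the multiplicity of the highest weight `χ` in
`k[Δ(det_m)]` equals its multiplicity in `k[Sym^m k^{m×m}]`: the quotient map is injective on the
highest-weight space of weight `χ` (`not_mem_orbitVanishingIdeal_detFormLex_of_body_le_succ`, the bouquet
criterion) and surjective onto that of the quotient (complete reducibility). [new] -/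
theorem orbitMultiplicity_detFormLex_eq_plethysmCoeff_of_body_le_succ {k : Type*} [Field k] [CharZero k]
    {m : ℕ} (i₀ : MatIdx m) (χ : Weight (MatIdx m)) (D : ℕ) (hD : χ.size = -((m * D : ℕ) : ℤ))
    (hbody : ((m * D : ℕ) : ℤ) + χ i₀ ≤ m + 1) :
    orbitMultiplicity k (detFormLex k m) m χ = plethysmCoeff k (MatIdx m) m χ := by
  classical
  have hm : m ≠ 0 := (Fin.pos (ofLex i₀).1).ne'
  set V : Submodule k (MvPolynomial (DegIdx (MatIdx m) m) k) := highestWeightSpace (coordRep (MatIdx m) k m) χ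
    with hV
  haveI : FiniteDimensional k V := finiteDimensional_highestWeightSpace_coordRep_holds hm χ
  let π : (coordRep (MatIdx m) k m).IntertwiningMap (orbitCoordRep (detFormLex k m) m) :=
    ⟨(Ideal.Quotient.mkₐ k (orbitVanishingIdeal (detFormLex k m) m)).toLinearMap,
      fun _ => LinearMap.ext fun _ => rfl⟩
  have hmap := map_highestWeightSpace_eq_of_surjective π (Ideal.Quotient.mkₐ_surjective k _)
    (isSemisimpleRepresentation_coordRep m) χ
  have hr := LinearMap.finrank_range_add_finrank_ker (π.toLinearMap ∘ₗ V.subtype)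
  rw [LinearMap.range_comp, Submodule.range_subtype] at hr
  have hker : LinearMap.ker (π.toLinearMap ∘ₗ V.subtype) = ⊥ := by
    rw [LinearMap.ker_eq_bot']
    intro F hF
    rw [LinearMap.comp_apply] at hF
    have hFI : (F : MvPolynomial (DegIdx (MatIdx m) m) k) ∈ orbitVanishingIdeal (detFormLex k m) m :=
      Ideal.Quotient.eq_zero_iff_mem.mp hF
    by_contra hne
    have hF0 : (F : MvPolynomial (DegIdx (MatIdx m) m) k) ≠ 0 := fun h =>
      hne (Subtype.ext (by rw [h]; rfl))
    exact not_mem_orbitVanishingIdeal_detFormLex_of_body_le_succ i₀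
      (highestWeightSpace_le_weightSpace _ _ F.2) hD hbody hF0 hFI
  rw [hker, finrank_bot, add_zero] at hr
  unfold orbitMultiplicity plethysmCoeff hwMultiplicity
  rw [← hmap]
  exact hr

/-- **No equations of `Det_m` up to body `m + 1`.**  For `λ ⊢ mδ` with at most `m²` parts and body
`|λ̄| = mδ - λ₁ ≤ m + 1`, the determinant orbit closure has NO equation of type `λ`:
`K_m(λ*) = mult_{λ*} ℂ[Δ(det_m)] = a_λ(δ[m])`.  Registered sub-goal of the crux (wall-breaker k7,
axis D). [new] -/
theorem noBodySuccEquations (m δ : ℕ) [NeZero m] (lam : Nat.Partition (m * δ)) (hlam : lam.parts.card ≤ m * m) (hbody : bodySize lam ≤ m + 1) : orbitMultiplicity ℂ (detFormLex ℂ m) m (partitionWeightLex m lam) = plethysmCoeff ℂ (MatIdx m) m (partitionWeightLex m lam) := by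
  have hm : 0 < m := Nat.pos_of_ne_zero (NeZero.ne m)
  have hmm : 0 < m * m := Nat.mul_pos hm hm
  refine orbitMultiplicity_detFormLex_eq_plethysmCoeff_of_body_le_succ
    (matIdxEquiv m ⟨m * m - 1, Nat.sub_one_lt_of_lt hmm⟩) _ δ
    (size_toMatIdx_dualOfPartition m lam hlam) ?_
  rw [partitionWeightLex_apply_top hmm]
  unfold bodySize at hbody
  have hsup := sup_parts_le lam
  omega

/-- **No flip up to body `m + 1`, in the crux's own currency.**  At `bodySize λ ≤ m + 1`, for EVERY
inner size `n ≤ m` and EVERY admissible centre `(U, r)`: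
`mult_{λ*} ℂ[Δ_m(X₀₀^{m-n} per_n)] ≤ a_λ(δ[m]) = K_m(λ*) ≤ dim T_U(λ)` (plethysm bound, `noBodySuccEquations`,
and the proved route crux `ValuativeBound`). [new] -/
theorem noBodySuccFlip : ∀ (n m : ℕ) [NeZero m], n ≤ m → ∀ (U : Submodule ℂ (MatIdx m → ℂ)) (r δ : ℕ) (lam : Nat.Partition (m * δ)), (∀ u ∈ U, (Matrix.of fun a b : Fin m => u (toLex (a, b))).rank ≤ r) → lam.parts.card ≤ m * m → bodySize lam ≤ m + 1 → let χ : Weight (MatIdx m) := (Weight.dualOfPartition (m * m) lam).toMatIdx; let T : Submodule ℂ (MvPolynomial (MatIdx m × MatIdx m) ℂ) := MvPolynomial.homogeneousSubmodule (MatIdx m × MatIdx m) ℂ (m * δ) ⊓ ((MvPolynomial.vanishingIdeal ℂ {p : MatIdx m × MatIdx m → ℂ | ∀ j : MatIdx m, (fun i => p (j, i)) ∈ U}) ^ (δ * (m - r))).restrictScalars ℂ ⊓ (⨅ (M : Matrix (MatIdx m) (MatIdx m) ℂ) (_ : linSubst (MatIdx m) ℂ M (detFormLex ℂ m) = detFormLex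 ℂ m), LinearMap.ker ((MvPolynomial.aeval (R := ℂ) fun p : MatIdx m × MatIdx m => ∑ l : MatIdx m, M l p.2 • MvPolynomial.X (p.1, l)).toLinearMap - LinearMap.id (R := ℂ) (M := MvPolynomial (MatIdx m × MatIdx m) ℂ))) ⊓ (⨅ (g : Matrix.GeneralLinearGroup (MatIdx m) ℂ) (_ : IsUpperTriangular g), LinearMap.ker ((MvPolynomial.aeval (R := ℂ) fun p : MatIdx m × MatIdx m => ∑ l : MatIdx m, ((g⁻¹ : Matrix.GeneralLinearGroup (MatIdx m) ℂ) : Matrix (MatIdx m) (MatIdx m) ℂ) p.1 l • MvPolynomial.X (l, p.2)).toLinearMap - weightChar χ g • LinearMap.id (R := ℂ) (M := MvPolynomial (MatIdx m × MatIdx m) ℂ))); orbitMultiplicity ℂ (paddedPerFormLex ℂ n m) m χ ≤ Module.finrank ℂ ↥T := by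
  intro n m _ hnm U r δ lam hU hlam hbody χ T
  have h1 : orbitMultiplicity ℂ (paddedPerFormLex ℂ n m) m χ ≤ plethysmCoeff ℂ (MatIdx m) m χ :=
    orbitMultiplicity_le_plethysmCoeff_holds _ (NeZero.ne m) (paddedPerFormLex_isHomogeneous ℂ hnm) χ
  have h2 : plethysmCoeff ℂ (MatIdx m) m χ = orbitMultiplicity ℂ (detFormLex ℂ m) m χ :=
    (noBodySuccEquations m δ lam hlam hbody).symm
  have h3 : orbitMultiplicity ℂ (detFormLex ℂ m) m χ ≤ Module.finrank ℂ ↥T :=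
    Summit.ValiantsHypothesis.ValiantsHypothesis.Theorems.ValuativeBound.ValuativeBound_proof
      m U r hU δ lam hlam
  rw [h2] at h1
  exact h1.trans h3

/-- **Where a valuative flip can live: body `≥ m + 2` and `nδ ≥ m + 2`.**  If at `(n, m)`, `n ≤ m`, some
admissible centre `(U, r)` flips at `λ ⊢ mδ` (`≤ m²` parts) — the body of the route decl `ValuativeFlip`
verbatim — then `m + 1 < bodySize λ` (`noBodySuccFlip`) and `m + 1 < n·δ` (Kadish–Landsberg
`δ(m-n) ≤ λ₁`, so `bodySize λ ≤ nδ`). [new] -/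
theorem body_gt_succ_and_degree_gt_of_flip {n m : ℕ} [NeZero m] (hnm : n ≤ m) (U : Submodule ℂ (MatIdx m → ℂ)) (r δ : ℕ) (lam : Nat.Partition (m * δ)) (hU : ∀ u ∈ U, (Matrix.of fun a b : Fin m => u (toLex (a, b))).rank ≤ r) (hlam : lam.parts.card ≤ m * m) (hflip : (let χ : Weight (MatIdx m) := (Weight.dualOfPartition (m * m) lam).toMatIdx; let T : Submodule ℂ (MvPolynomial (MatIdx m × MatIdx m) ℂ) := MvPolynomial.homogeneousSubmodule (MatIdx m × MatIdx m) ℂ (m * δ) ⊓ ((MvPolynomial.vanishingIdeal ℂ {p : MatIdx m × MatIdx m → ℂ | ∀ j : MatIdx m, (fun i => p (j, i)) ∈ U}) ^ (δ * (m - r))).restrictScalars ℂ ⊓ (⨅ (M : Matrix (MatIdx m) (MatIdx m) ℂ) (_ : linSubst (MatIdx m) ℂ M (detFormLex ℂ m) = detFormLex ℂ m), LinearMap.ker ((MvPolynomial.aeval (R := ℂ) fun p : MatIdx m × MatIdx m => ∑ l : MatIdx m, M l p.2 • MvPolynomial.X (p.1, l)).toLinearMap - LinearMap.id (R := ℂ)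 (M := MvPolynomial (MatIdx m × MatIdx m) ℂ))) ⊓ (⨅ (g : Matrix.GeneralLinearGroup (MatIdx m) ℂ) (_ : IsUpperTriangular g), LinearMap.ker ((MvPolynomial.aeval (R := ℂ) fun p : MatIdx m × MatIdx m => ∑ l : MatIdx m, ((g⁻¹ : Matrix.GeneralLinearGroup (MatIdx m) ℂ) : Matrix (MatIdx m) (MatIdx m) ℂ) p.1 l • MvPolynomial.X (l, p.2)).toLinearMap - weightChar χ g • LinearMap.id (R := ℂ) (M := MvPolynomial (MatIdx m × MatIdx m) ℂ))); Module.finrank ℂ ↥T < orbitMultiplicity ℂ (paddedPerFormLex ℂ n m) m χ)) : m + 1 < bodySize lam ∧ m + 1 < n * δ := by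
  have hbody : m + 1 < bodySize lam := by
    by_contra hle
    rw [not_lt] at hle
    have h := noBodySuccFlip n m hnm U r δ lam hU hlam hle
    exact absurd hflip (not_lt.mpr h)
  refine ⟨hbody, ?_⟩
  -- the flip makes `λ*` occur in `ℂ[Δ_m(pp)]`; Kadish–Landsberg bounds the body by `nδ`
  have hocc : HasHighestWeight (paddedPerOrbitRep ℂ n m) (Weight.dualOfPartition (m * m) lam).toMatIdx := by
    intro hbot
    have h0 : orbitMultiplicity ℂ (paddedPerFormLex ℂ n m) m
        (Weight.dualOfPartition (m * m) lam).toMatIdx = 0 := by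
      rw [orbitMultiplicity, hwMultiplicity]
      change Module.finrank ℂ ↥(highestWeightSpace (paddedPerOrbitRep ℂ n m) _) = 0
      rw [hbot]
      exact finrank_bot ℂ _
    have h1 := hflip
    simp only [h0] at h1
    exact Nat.not_lt_zero _ h1
  obtain ⟨hKL, -⟩ :=
    NoValuativeFlip.kadishLandsberg_of_hasHighestWeight_paddedPerOrbitRep hnm lam hlam hocc
  unfold bodySize at hbody
  have hsup := sup_parts_le lam
  have hmul : δ * (m - n) = δ * m - δ * n := Nat.mul_sub δ m n
  have hcomm : δ * m = m * δ := Nat.mul_comm δ m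
  have hcomm' : n * δ = δ * n := Nat.mul_comm n δ
  omega

end

end Summit.ValiantsHypothesis.ValiantsHypothesis.Theorems.ValuativeFlip
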